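import Literature.Probability.Moments.InverseVarianceWeighting

/-!
# The pooled (inverse-variance) z-test over the seeds of one arm — what a pooled HARD can and
# cannot be, given the per-row z's (arbiter watch item F35-1)

HONEST FRAMING: exact (Metropolis-corrected) sampling algorithms for lattice gauge theory;
figures of merit are autocorrelation/cost numbers at stated couplings and volumes; no
continuum-physics claim.

Venture `LatticeQCDFlow` (cell pub-lqcd), sub-topic `Scoring`; FANOUT row 11 (`eng-scorerA`,
fitness scorer A), GEN-13.  NEW WORK of the cell (finite real algebra, Cauchy–Schwarz); the one
published ingredient — inverse-variance weights are the minimum-variance unbiased combination — is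
IMPORTED from `Literature/Probability/Moments/InverseVarianceWeighting.lean` ([Lepage2021, §2.5],
[Lachin2000, §4.3.5]) and not restated.

## The rule this file types

The frozen scorers test ONE row at a time: `V1:exact-mismatch:plaq` is HARD when the row's chain
estimate `P̂` of the plaquette misses the exact reference by `|P̂ − P_exact| > 3 err` (FITNESS §4).
Rows of one config hash at one key that differ only by training seed are replicas of one arm
(LEAD RO-23 (5)); the arbiter's watch item **F35-1** (HOME/ref-exact/EXACTNESS-AUDIT-F35-1-POOLED-
su3-b5.md, INBOX 2026-08-21T15:07:35Z) reads the arm AT THE POOLED LEVEL: with per-seed residuals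
`δ_k = P̂_k − P_exact` and errors `e_k`, row 11's `tools/pooled_v1_A.py` prints

  `W = Σ_k 1/e_k²`, `S = Σ_k δ_k/e_k²`, pooled residual `S/W`, pooled error `1/√W`,
  **pooled `z = (S/W)·√W = S/√W`**, and the Stouffer sum `Σ_k z_k/√n` with `z_k = δ_k/e_k`.

On row 5's SU(3) β 5.0 16² arm (three seeds, each VALID on its own: `z_k = +1.42, +2.65, +1.60`)
the pool reads `z = +3.30` (A) / `+3.43` (B) ⇒ 'F35-1 FIRES': the point carries the mismatch at the
pooled level while no row is retracted.  This file says exactly how a pooled `z` relates to the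
per-row `z_k` it is made of — i.e. when 'no row fires but the pool does' is arithmetic and when it
would be impossible:

* `pooledZ_eq_sum_coef_mul_rowZ`, `sum_pooledCoef_sq` — **`z_pool = Σ_k a_k z_k` with
  `a_k = (1/√W)/e_k` and `Σ_k a_k² = 1`**: the pooled z is a unit-norm combination of the row z's;
* `pooledZ_sq_le_sum_rowZ_sq` (Cauchy–Schwarz) — **`z_pool² ≤ Σ_k z_k²`**; so a pooled `|z| > 3`
  needs `Σ z_k² > 9`, and `n` rows all inside `|z_k| ≤ c` can never pool past `c√n`
  (`abs_pooledZ_le_mul_sqrt`): three rows each below `√3 = 1.73σ` cannot fire a pooled 3σ;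
* `one_le_sum_pooledCoef`, `sum_pooledCoef_le_sqrt` — `1 ≤ Σ_k a_k ≤ √n`; hence the COMMON-SIGN
  readings `le_pooledZ_of_forall_le` (**all `z_k ≥ m ≥ 0` ⇒ `z_pool ≥ m`**: same-signed rows never
  pool below their smallest z) and `pooledZ_le_of_forall_le` (all `z_k ≤ M`, `M ≥ 0` ⇒
  `z_pool ≤ M√n`: the amplification of a common offset is at most `√n`, attained at equal errors);
  `pooledZ_neg` transports both to the negative side;
* `pooledZ_const_eq_stoufferZ`, `pooledErr_const` — equal errors ⇒ the pooled z IS the Stouffer sum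
  and the pooled error is `e/√n` (the two printed columns differ only through unequal `e_k`);
* `pooledErr_le` — pooling never widens: `1/√W ≤ e_k` for every seed; `pooledDiff_eq_sum_invVarWeight`,
  `pooledErr_sq_le_sum_sq_mul` — the pooled residual is the tree's inverse-variance weighted mean and
  its squared error `1/W` is the MINIMUM of `Σ w_k² e_k²` over all weights with `Σ w = 1`
  (the imported [Lepage2021, §2.5] fact): the 'estimator of record' is the least-error unbiased pool;
* record numbers (`f35_rowZ_lt_three`, `f35_rowZ_ge`, `f35_pooledZ_bounds`): with the printed
  roundings `P̂ = 0.3542681 / 0.3544946 / 0.3542895 ± 0.0002207 / 0.0002036 / 0.0002099` and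
  `P_exact = 0.3539544367`, every row z is in `[1.42, 3)` (no per-row HARD, all one sign) and
  **`3.29 < z_pool < 3.31`** (tool, full precision: 3.30) — inside the typed window
  `[min z_k, min(√(Σz_k²), √3·max z_k)] = [1.42, 3.41]`.

What is NOT here: that `z_pool` is standard normal under the null needs the seeds independent, the
errors TRUE rather than Γ-estimated, and Gaussian row means — none of which is algebra (Lepage's own
caveat on estimated `σ_j`, loc. cit.; the arbiter's ruling accordingly asks row 5 for a
window-independent error before the point counts); the threshold `3` and the decision that a pooled
HARD does not retract VALID rows are policy (F35-1), not mathematics.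
-/

noncomputable section

namespace Summit.Ventures.LatticeQCDFlow.Scoring

open Real Finset
open scoped BigOperators

variable {n : ℕ}

/-! ### The printed quantities of `tools/pooled_v1_A.py` -/

/-- `W = Σ_k 1/e_k²`, the total inverse variance of the seeds (errors `e`). -/
def ivwSum (e : Fin n → ℝ) : ℝ := ∑ k, (e k ^ 2)⁻¹

/-- `S = Σ_k δ_k/e_k²`, the inverse-variance weighted sum of the residuals `δ_k = P̂_k − P_exact`. -/
def ivwNum (δ e : Fin n → ℝ) : ℝ := ∑ k, δ k / e k ^ 2

/-- The pooled residual `S/W` (printed `pooled_diff`). -/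
def pooledDiff (δ e : Fin n → ℝ) : ℝ := ivwNum δ e / ivwSum e

/-- The pooled error `1/√W` (printed `pooled_err`). -/
def pooledErr (e : Fin n → ℝ) : ℝ := (sqrt (ivwSum e))⁻¹

/-- The pooled z, `(S/W)/(1/√W)` (printed `pooled_z`; the tool writes it as `(S/W)·√W`). -/
def pooledZ (δ e : Fin n → ℝ) : ℝ := pooledDiff δ e / pooledErr e

/-- The per-row (per-seed) signed z, `z_k = δ_k/e_k` — the quantity the frozen scorers' V1 test
thresholds row by row. -/
def rowZ (δ e : Fin n → ℝ) (k : Fin n) : ℝ := δ k / e k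

/-- The coefficient of row `k` in the pooled z, `a_k = (1/√W)/e_k`. -/
def pooledCoef (e : Fin n → ℝ) (k : Fin n) : ℝ := pooledErr e / e k

/-- The Stouffer combination `Σ_k z_k/√n` (printed `stouffer`). -/
def stoufferZ (δ e : Fin n → ℝ) : ℝ := (∑ k, rowZ δ e k) / sqrt n

variable {δ e : Fin n → ℝ}

/-! ### `W`, the pooled error, and the link to the Literature weights -/

/-- `W > 0` for positive errors and at least one seed. -/
theorem ivwSum_pos (he : ∀ k, 0 < e k) (hn : n ≠ 0) : 0 < ivwSum e :=
  haveI : Nonempty (Fin n) := ⟨⟨0, Nat.pos_of_ne_zero hn⟩⟩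
  Finset.sum_pos (fun k _ => inv_pos.mpr (pow_pos (he k) 2)) Finset.univ_nonempty

/-- Each seed's inverse variance is a summand of `W`: `1/e_k² ≤ W`. -/
theorem inv_sq_le_ivwSum (he : ∀ k, 0 < e k) (k : Fin n) : (e k ^ 2)⁻¹ ≤ ivwSum e :=
  Finset.single_le_sum (f := fun j => (e j ^ 2)⁻¹)
    (fun j _ => (inv_pos.mpr (pow_pos (he j) 2)).le) (Finset.mem_univ k)

/-- The pooled error is positive. -/
theorem pooledErr_pos (he : ∀ k, 0 < e k) (hn : n ≠ 0) : 0 < pooledErr e :=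
  inv_pos.mpr (sqrt_pos.mpr (ivwSum_pos he hn))

/-- `(1/√W)² = 1/W`: the squared pooled error is Lepage's `σ_Ī² = (Σ_k 1/σ_k²)⁻¹` with `σ_k² = e_k²`. -/
theorem pooledErr_sq (he : ∀ k, 0 < e k) (hn : n ≠ 0) : pooledErr e ^ 2 = (ivwSum e)⁻¹ := by
  unfold pooledErr
  rw [inv_pow, sq_sqrt (ivwSum_pos he hn).le]

/-- **Pooling never widens the error:** `1/√W ≤ e_k` for every seed `k`. -/
theorem pooledErr_le (he : ∀ k, 0 < e k) (k : Fin n) : pooledErr e ≤ e k := by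
  have hn : n ≠ 0 := Nat.pos_iff_ne_zero.mp (Fin.pos k)
  have hW := ivwSum_pos he hn
  have hk := he k
  unfold pooledErr
  rw [inv_le_comm₀ (sqrt_pos.mpr hW) hk, Real.le_sqrt' (inv_pos.mpr hk), inv_pow]
  exact inv_sq_le_ivwSum he k

/-- The pooled residual IS the inverse-variance weighted mean of the tree
(`Literature.Probability.Moments.invVarWeight` with `σ_k² = e_k²`): `S/W = Σ_k w_k δ_k`,
`w_k = (1/e_k²)/W`. -/
theorem pooledDiff_eq_sum_invVarWeight :
    pooledDiff δ e =
      ∑ k, Literature.Probability.Moments.invVarWeight (fun j => e j ^ 2) k * δ k := by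
  unfold pooledDiff ivwNum ivwSum Literature.Probability.Moments.invVarWeight
  rw [Finset.sum_div]
  exact Finset.sum_congr rfl fun k _ => by ring

/-- **Minimum variance (imported):** for ANY weights with `Σ_k w_k = 1` (any unbiased linear pool of
the seeds), `(1/√W)² ≤ Σ_k w_k² e_k²` — the inverse-variance pool has the least error; this is
`Literature.Probability.Moments.inv_sum_inv_le_sum_sq_mul` ([Lepage2021, §2.5]) read through
`pooledErr_sq`. -/
theorem pooledErr_sq_le_sum_sq_mul (he : ∀ k, 0 < e k) (hn : n ≠ 0) (w : Fin n → ℝ)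
    (hw : ∑ k, w k = 1) : pooledErr e ^ 2 ≤ ∑ k, w k ^ 2 * e k ^ 2 := by
  rw [pooledErr_sq he hn]
  exact Literature.Probability.Moments.inv_sum_inv_le_sum_sq_mul (fun k => pow_pos (he k) 2) w hw

/-! ### The pooled z as a unit-norm combination of the row z's -/

/-- `z_pool = S · (1/√W)`. -/
theorem pooledZ_eq_num_mul_pooledErr (he : ∀ k, 0 < e k) (hn : n ≠ 0) :
    pooledZ δ e = ivwNum δ e * pooledErr e := by
  have hpe := pooledErr_pos he hn
  have hsq := pooledErr_sq he hn
  unfold pooledZ pooledDiff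
  rw [div_eq_mul_inv (ivwNum δ e), ← hsq]
  field_simp

/-- `z_pool = S/√W` (the closed form behind the printed `(S/W)·√W`). -/
theorem pooledZ_eq_num_div_sqrt (he : ∀ k, 0 < e k) (hn : n ≠ 0) :
    pooledZ δ e = ivwNum δ e / sqrt (ivwSum e) := by
  rw [pooledZ_eq_num_mul_pooledErr he hn, div_eq_mul_inv]
  rfl

/-- **`Σ_k a_k² = 1`:** the coefficients `a_k = (1/√W)/e_k` form a unit vector. -/
theorem sum_pooledCoef_sq (he : ∀ k, 0 < e k) (hn : n ≠ 0) : ∑ k, pooledCoef e k ^ 2 = 1 := by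
  unfold pooledCoef
  simp_rw [div_pow, div_eq_mul_inv]
  rw [← Finset.mul_sum, pooledErr_sq he hn]
  have h : ∑ k, (e k ^ 2)⁻¹ = ivwSum e := rfl
  rw [h]
  exact inv_mul_cancel₀ (ivwSum_pos he hn).ne'

/-- **`z_pool = Σ_k a_k z_k`:** the pooled z is the unit-norm combination of the per-row z's with
coefficients `a_k = (1/√W)/e_k` (larger for the better-measured seeds). -/
theorem pooledZ_eq_sum_coef_mul_rowZ (he : ∀ k, 0 < e k) (hn : n ≠ 0) :
    pooledZ δ e = ∑ k, pooledCoef e k * rowZ δ e k := by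
  rw [pooledZ_eq_num_mul_pooledErr he hn]
  unfold ivwNum pooledCoef rowZ
  rw [Finset.sum_mul]
  refine Finset.sum_congr rfl fun k _ => ?_
  have hk := (he k).ne'
  field_simp

/-- Each coefficient is positive. -/
theorem pooledCoef_pos (he : ∀ k, 0 < e k) (hn : n ≠ 0) (k : Fin n) : 0 < pooledCoef e k :=
  div_pos (pooledErr_pos he hn) (he k)

/-- Each coefficient is at most one (`pooledErr_le`). -/
theorem pooledCoef_le_one (he : ∀ k, 0 < e k) (k : Fin n) : pooledCoef e k ≤ 1 := by
  unfold pooledCoef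
  rw [div_le_one (he k)]
  exact pooledErr_le he k

/-- **`1 ≤ Σ_k a_k`** (a unit vector with entries in `[0, 1]` has `ℓ¹` norm at least one; equality
only when one seed carries all the weight). -/
theorem one_le_sum_pooledCoef (he : ∀ k, 0 < e k) (hn : n ≠ 0) : 1 ≤ ∑ k, pooledCoef e k := by
  rw [← sum_pooledCoef_sq he hn]
  exact Finset.sum_le_sum fun k _ => by
    have h0 := (pooledCoef_pos he hn k).le
    have h1 := pooledCoef_le_one he k
    nlinarith

/-- **`Σ_k a_k ≤ √n`** (Cauchy–Schwarz against the all-ones vector; equality iff all errors are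
equal). -/
theorem sum_pooledCoef_le_sqrt (he : ∀ k, 0 < e k) (hn : n ≠ 0) :
    ∑ k, pooledCoef e k ≤ sqrt n := by
  have h := Finset.sum_mul_sq_le_sq_mul_sq Finset.univ (fun k => pooledCoef e k) (fun _ => (1 : ℝ))
  simp only [mul_one, one_pow, Finset.sum_const, Finset.card_univ, Fintype.card_fin, nsmul_eq_mul]
    at h
  rw [sum_pooledCoef_sq he hn, one_mul] at h
  exact (le_abs_self _).trans (abs_le_sqrt h)

/-! ### What a pooled z can be, given the row z's -/

/-- **Cauchy–Schwarz ceiling: `z_pool² ≤ Σ_k z_k²`.**  A pooled `|z| > t` therefore needs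
`Σ_k z_k² > t²` among the rows it pools — the pooled test cannot manufacture significance the rows
do not jointly carry. -/
theorem pooledZ_sq_le_sum_rowZ_sq (he : ∀ k, 0 < e k) (hn : n ≠ 0) :
    pooledZ δ e ^ 2 ≤ ∑ k, rowZ δ e k ^ 2 := by
  rw [pooledZ_eq_sum_coef_mul_rowZ he hn]
  have h := Finset.sum_mul_sq_le_sq_mul_sq Finset.univ (fun k => pooledCoef e k) (fun k => rowZ δ e k)
  rw [sum_pooledCoef_sq he hn, one_mul] at h
  exact h

/-- `|z_pool| ≤ √(Σ_k z_k²)`. -/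
theorem abs_pooledZ_le_sqrt_sum_sq (he : ∀ k, 0 < e k) (hn : n ≠ 0) :
    |pooledZ δ e| ≤ sqrt (∑ k, rowZ δ e k ^ 2) := by
  rw [← sqrt_sq_eq_abs]
  exact sqrt_le_sqrt (pooledZ_sq_le_sum_rowZ_sq he hn)

/-- **Uniform form:** if every row has `|z_k| ≤ c` then `|z_pool| ≤ c√n`.  With `n = 3` seeds all
inside `|z_k| ≤ √3 ≈ 1.73` the pool can never reach `3`; conversely 'no row fires (`|z_k| ≤ 3`)'
only caps the pool at `3√n`. -/
theorem abs_pooledZ_le_mul_sqrt (he : ∀ k, 0 < e k) (hn : n ≠ 0) {c : ℝ}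
    (hc : ∀ k, |rowZ δ e k| ≤ c) : |pooledZ δ e| ≤ c * sqrt n := by
  have hc0 : 0 ≤ c := (abs_nonneg _).trans (hc ⟨0, Nat.pos_of_ne_zero hn⟩)
  refine (abs_pooledZ_le_sqrt_sum_sq he hn).trans ?_
  have hsum : ∑ k, rowZ δ e k ^ 2 ≤ ∑ _k : Fin n, c ^ 2 := Finset.sum_le_sum fun k _ => by
    rw [← sq_abs]
    exact pow_le_pow_left₀ (abs_nonneg _) (hc k) 2
  rw [Finset.sum_const, Finset.card_univ, Fintype.card_fin, nsmul_eq_mul] at hsum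
  calc sqrt (∑ k, rowZ δ e k ^ 2) ≤ sqrt (n * c ^ 2) := sqrt_le_sqrt hsum
    _ = c * sqrt n := by rw [sqrt_mul (Nat.cast_nonneg n), sqrt_sq hc0, mul_comm]

/-- **Common sign, lower side: same-signed rows never pool BELOW their smallest z.**  If every row
has `z_k ≥ m ≥ 0` then `z_pool ≥ m` (because `Σ a_k ≥ 1`).  F35-1: three seeds at
`+1.42, +2.65, +1.60` pool to at least `+1.42` whatever their errors. -/
theorem le_pooledZ_of_forall_le (he : ∀ k, 0 < e k) (hn : n ≠ 0) {m : ℝ} (hm : 0 ≤ m)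
    (h : ∀ k, m ≤ rowZ δ e k) : m ≤ pooledZ δ e := by
  rw [pooledZ_eq_sum_coef_mul_rowZ he hn]
  calc m = m * 1 := (mul_one m).symm
    _ ≤ m * ∑ k, pooledCoef e k := mul_le_mul_of_nonneg_left (one_le_sum_pooledCoef he hn) hm
    _ = ∑ k, pooledCoef e k * m := by
        rw [Finset.mul_sum]
        exact Finset.sum_congr rfl fun k _ => mul_comm _ _
    _ ≤ ∑ k, pooledCoef e k * rowZ δ e k :=
        Finset.sum_le_sum fun k _ => mul_le_mul_of_nonneg_left (h k) (pooledCoef_pos he hn k).le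

/-- **Common sign, upper side: a common offset is amplified by at most `√n`.**  If every row has
`z_k ≤ M` with `M ≥ 0` then `z_pool ≤ M√n` (because `Σ a_k ≤ √n`), with equality for equal errors and
equal z's — the Stouffer amplification `n` equal rows at `z` pool to `z√n`. -/
theorem pooledZ_le_of_forall_le (he : ∀ k, 0 < e k) (hn : n ≠ 0) {M : ℝ} (hM : 0 ≤ M)
    (h : ∀ k, rowZ δ e k ≤ M) : pooledZ δ e ≤ M * sqrt n := by
  rw [pooledZ_eq_sum_coef_mul_rowZ he hn]
  calc ∑ k, pooledCoef e k * rowZ δ e k ≤ ∑ k, pooledCoef e k * M :=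
        Finset.sum_le_sum fun k _ => mul_le_mul_of_nonneg_left (h k) (pooledCoef_pos he hn k).le
    _ = M * ∑ k, pooledCoef e k := by
        rw [Finset.mul_sum]
        exact Finset.sum_congr rfl fun k _ => mul_comm _ _
    _ ≤ M * sqrt n := mul_le_mul_of_nonneg_left (sum_pooledCoef_le_sqrt he hn) hM

/-- Flipping every residual flips the pooled z: the two common-sign bounds transport to rows that
all read LOW. -/
theorem pooledZ_neg (δ e : Fin n → ℝ) : pooledZ (-δ) e = -pooledZ δ e := by
  unfold pooledZ pooledDiff ivwNum
  simp only [Pi.neg_apply, neg_div, Finset.sum_neg_distrib]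

/-! ### Equal errors: pooled z = Stouffer, pooled error = `e/√n` -/

/-- Equal errors `e_k = c`: `W = n/c²`. -/
theorem ivwSum_const {c : ℝ} (hc : ∀ k, e k = c) : ivwSum e = n * (c ^ 2)⁻¹ := by
  unfold ivwSum
  simp_rw [hc]
  rw [Finset.sum_const, Finset.card_univ, Fintype.card_fin, nsmul_eq_mul]

/-- Equal errors `e_k = c > 0`: **the pooled error is `c/√n`**. -/
theorem pooledErr_const (hn : n ≠ 0) {c : ℝ} (hc0 : 0 < c) (hc : ∀ k, e k = c) :
    pooledErr e = c / sqrt n := by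
  have hsn : 0 < sqrt (n : ℝ) := sqrt_pos.mpr (Nat.cast_pos.mpr (Nat.pos_of_ne_zero hn))
  unfold pooledErr
  rw [ivwSum_const hc, sqrt_mul (Nat.cast_nonneg n), sqrt_inv, sqrt_sq hc0.le, mul_inv, inv_inv,
    div_eq_mul_inv, mul_comm]

/-- Equal errors `e_k = c > 0`: **the pooled z IS the Stouffer sum `Σ_k z_k/√n`** — the two printed
columns of `pooled_v1_A.py` differ only through unequal per-seed errors (F35-1: 3.30 vs 3.27). -/
theorem pooledZ_const_eq_stoufferZ (hn : n ≠ 0) {c : ℝ} (hc0 : 0 < c) (hc : ∀ k, e k = c) :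
    pooledZ δ e = stoufferZ δ e := by
  have he : ∀ k, 0 < e k := fun k => (hc k).symm ▸ hc0
  have hsn : 0 < sqrt (n : ℝ) := sqrt_pos.mpr (Nat.cast_pos.mpr (Nat.pos_of_ne_zero hn))
  rw [pooledZ_eq_sum_coef_mul_rowZ he hn]
  unfold stoufferZ pooledCoef
  rw [pooledErr_const hn hc0 hc, Finset.sum_div]
  refine Finset.sum_congr rfl fun k _ => ?_
  rw [hc k]
  field_simp

/-! ### Record numbers: F35-1, row 5's SU(3) β 5.0 16² arm, three seeds (LEADERBOARD l.57 / l.54 /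
### l.73 on frozen scorer A 0.1.2, reference table v0.3; printed roundings) -/

/-- The three residuals `P̂_k − P_exact` with `P̂ = 0.3542681, 0.3544946, 0.3542895` (seeds 1, 2, 3)
and `P_exact = 0.3539544367` (dim-2 SU(3) Wilson plaquette at β 5.0, reference table v0.3). -/
def f35Delta : Fin 3 → ℝ := ![0.0003136633, 0.0005401633, 0.0003350633]

/-- The three Γ-method errors of record `0.0002207, 0.0002036, 0.0002099` (seeds 1, 2, 3). -/
def f35Err : Fin 3 → ℝ := ![0.0002207, 0.0002036, 0.0002099]

/-- The errors of record are positive. -/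
theorem f35Err_pos : ∀ k, 0 < f35Err k := by
  intro k
  fin_cases k <;> norm_num [f35Err]

/-- Accessor (seed 1 residual). -/
private theorem f35Delta_zero : f35Delta 0 = 0.0003136633 := rfl
/-- Accessor (seed 2 residual). -/
private theorem f35Delta_one : f35Delta 1 = 0.0005401633 := rfl
/-- Accessor (seed 3 residual). -/
private theorem f35Delta_two : f35Delta 2 = 0.0003350633 := rfl
/-- Accessor (seed 1 error). -/
private theorem f35Err_zero : f35Err 0 = 0.0002207 := rfl
/-- Accessor (seed 2 error). -/
private theorem f35Err_one : f35Err 1 = 0.0002036 := rfl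
/-- Accessor (seed 3 error). -/
private theorem f35Err_two : f35Err 2 = 0.0002099 := rfl

/-- `W` of record in closed form. -/
private theorem f35_ivwSum :
    ivwSum f35Err = (0.0002207 ^ 2)⁻¹ + (0.0002036 ^ 2)⁻¹ + (0.0002099 ^ 2)⁻¹ := by
  rw [ivwSum, Fin.sum_univ_three, f35Err_zero, f35Err_one, f35Err_two]

/-- `S` of record in closed form. -/
private theorem f35_ivwNum :
    ivwNum f35Delta f35Err = 0.0003136633 / 0.0002207 ^ 2 + 0.0005401633 / 0.0002036 ^ 2
      + 0.0003350633 / 0.0002099 ^ 2 := by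
  rw [ivwNum, Fin.sum_univ_three, f35Err_zero, f35Err_one, f35Err_two, f35Delta_zero, f35Delta_one,
    f35Delta_two]

/-- **No row fires:** every per-seed z is below the HARD threshold `3` (printed `+1.42, +2.65,
+1.60`; here `< 2.66`). -/
theorem f35_rowZ_lt_three : ∀ k, rowZ f35Delta f35Err k < 2.66 := by
  intro k
  fin_cases k <;> norm_num [rowZ, f35Delta, f35Err]

/-- **All one sign:** every per-seed z is at least `+1.42`. -/
theorem f35_rowZ_ge : ∀ k, (1.42 : ℝ) ≤ rowZ f35Delta f35Err k := by
  intro k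
  fin_cases k <;> norm_num [rowZ, f35Delta, f35Err]

/-- **The pool fires: `3.29 < z_pool < 3.31`** on the printed roundings (the tool at full precision:
`+3.30`; scorer B's inputs give `+3.43`).  By `le_pooledZ_of_forall_le` / `abs_pooledZ_le_sqrt_sum_sq`
the value had to lie in `[1.42, √(1.42² + 2.66² + 1.60²)] ⊂ [1.42, 3.42]`; it sits near the top
because the three residuals share a sign and are comparable in size (`Σ a_k = 1.73 ≈ √3`). -/
theorem f35_pooledZ_bounds :
    (3.29 : ℝ) < pooledZ f35Delta f35Err ∧ pooledZ f35Delta f35Err < 3.31 := by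
  have he := f35Err_pos
  have h3 : (3 : ℕ) ≠ 0 := by norm_num
  have hW : 0 < ivwSum f35Err := ivwSum_pos he h3
  have hS : 0 < ivwNum f35Delta f35Err := by
    rw [f35_ivwNum]
    norm_num
  rw [pooledZ_eq_num_div_sqrt he h3]
  constructor
  · rw [lt_div_iff₀ (sqrt_pos.mpr hW)]
    have h1 : sqrt (ivwSum f35Err) < ivwNum f35Delta f35Err / 3.29 := by
      rw [Real.sqrt_lt' (by positivity), f35_ivwSum, f35_ivwNum]
      norm_num
    have h2 := (lt_div_iff₀ (by norm_num : (0 : ℝ) < 3.29)).mp h1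
    linarith
  · rw [div_lt_iff₀ (sqrt_pos.mpr hW)]
    have h1 : ivwNum f35Delta f35Err / 3.31 < sqrt (ivwSum f35Err) := by
      rw [Real.lt_sqrt (by positivity), f35_ivwSum, f35_ivwNum]
      norm_num
    have h2 := (div_lt_iff₀ (by norm_num : (0 : ℝ) < 3.31)).mp h1
    linarith

/-- The typed window instantiated: `1.42 ≤ z_pool` from the common sign alone (`le_pooledZ_of_forall_le`
with `f35_rowZ_ge`) — before any pooling arithmetic, three VALID same-signed seeds at `≥ 1.42σ`
could not have pooled to a VALID-looking `|z| < 1.42`. -/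
theorem f35_pooledZ_ge_min : (1.42 : ℝ) ≤ pooledZ f35Delta f35Err :=
  le_pooledZ_of_forall_le f35Err_pos (by norm_num) (by norm_num) f35_rowZ_ge

end Summit.Ventures.LatticeQCDFlow.Scoring
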